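import Summits.AtomisticToContinuum.HydrodynamicLimit.Theses.OneFlightGossipEngine
import Summits.AtomisticToContinuum.HydrodynamicLimit.Theorems.OneFlightGossipEngineClampedTransferDockOfInputs
import Summits.AtomisticToContinuum.HydrodynamicLimit.Theorems.OneFlightGossipEngineClampedTransferDockSeet
import HarnessLib

/-!
# Sketch — crux-ideate stmt-AtomisticToContinuum-17733 (ideator 2, round 1)

First lemmas of the idea cards for the crux
`OneFlightGossipEngine.ClampedTransferDockOfInputs :=
  SEET → BCL → LCT → EAT → KCWF → CAT → HydrodynamicLimit`.

Idea `compose-landed-closing`: the crux IS the landed conditional closing of the dock line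
(`ClampedTransferDockSketch.clampedTransferDock_of_inputs`, p140743) with its seventh argument ECT
discharged by the landed `ClampedTransferDockSeet.seet_imp_energyCurrentTails` (SEET ⇒ ECT at rate 1).
The four route statements BCL/LCT/EAT/SEET and KCWF are byte-identical with the Theorems-side defs the
landed theorem is typed over, so the term below should elaborate by δ-unfolding alone.
-/

namespace Summit.AtomisticToContinuum.HydrodynamicLimit.Cruxes.ClampedTransferDockOfInputs.IdeatorTwo

open Summit.AtomisticToContinuum.HydrodynamicLimit.Theses.OneFlightGossipEngine
open Summit.AtomisticToContinuum.HydrodynamicLimit.Theorems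

/-- §1 (idea `compose-landed-closing`, First lemma = the whole crux): direct composition. -/
theorem clampedTransferDockOfInputs_direct : ClampedTransferDockOfInputs :=
  fun hS hB h₃ h₄ hK h₇ =>
    ClampedTransferDockSketch.clampedTransferDock_of_inputs hS hB h₃ h₄ hK h₇
      (ClampedTransferDockSeet.seet_imp_energyCurrentTails hS)

/-- §2 The five definitional bridges, recorded one by one (fallback if §1 ever stops unfolding:
rewrite along these and apply the landed theorem). -/
theorem seet_iff : SuperExponentialEnergyTails ↔ ClampedTransferDockCubicRate.SuperExponentialEnergyTails := Iff.rfl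
theorem bcl_iff : BandCoherenceLDAlongFamilies ↔ ClampedTransferDockCubicRate.BandCoherenceLDFamily := Iff.rfl
theorem lct_iff : LocalClampedTransferLDAlongFamilies ↔ HydroLimitInBandOfHeart.LocalClampedTransferWindowLDFamily := Iff.rfl
theorem eat_iff : EnergyActivityTails ↔ HydroLimitInBandOfHeart.CollisionEnergyActivityTails := Iff.rfl
theorem kcwf_iff : KineticCurrentsLDAlongFamilies ↔ HydroLimitInBandOfHeart.KineticCurrentsWindowLDFamily := Iff.rfl
theorem dock_unfold : ClampedTransferDock ↔
    (KineticCurrentsLDAlongFamilies → CollisionActivityTails → EnergyCurrentTails → _root_.HydrodynamicLimit) := Iff.rfl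

/-- §3 Plan shape (only if the crux protocol insists on a registered skeleton): the legal two-stub line,
with BOTH stubs already closed by the landed theorems (no `sorry` anywhere) and the composition
concluding the crux BY NAME. -/
theorem stub_dock : SuperExponentialEnergyTails → BandCoherenceLDAlongFamilies →
    LocalClampedTransferLDAlongFamilies → EnergyActivityTails → ClampedTransferDock :=
  ClampedTransferDockSketch.clampedTransferDock_of_inputs

theorem stub_ect : SuperExponentialEnergyTails → EnergyCurrentTails :=
  ClampedTransferDockSeet.seet_imp_energyCurrentTails

theorem ClampedTransferDockOfInputs_of :
    (SuperExponentialEnergyTails → BandCoherenceLDAlongFamilies → LocalClampedTransferLDAlongFamilies →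
      EnergyActivityTails → ClampedTransferDock) →
    (SuperExponentialEnergyTails → EnergyCurrentTails) →
    ClampedTransferDockOfInputs :=
  fun hD hE hS hB h₃ h₄ hK h₇ => hD hS hB h₃ h₄ hK h₇ (hE hS)

/-- §3′ The skeleton closes at once. -/
theorem clampedTransferDockOfInputs_via_skeleton : ClampedTransferDockOfInputs :=
  ClampedTransferDockOfInputs_of stub_dock stub_ect

end Summit.AtomisticToContinuum.HydrodynamicLimit.Cruxes.ClampedTransferDockOfInputs.IdeatorTwo
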